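import Summits.BirchSwinnertonDyer.BirchSwinnertonDyer.Theorems.TwoAdicConverseMultLambdaWallSplit
import Literature.NumberTheory.EllipticCurves.Kato2004.DivisibilityInputsMultiplicativeDescentSplit
import HarnessLib

/-!
# Route `TwoAdicConverse` (rung S3), multiplicative branch, BOTH signs: the two `λ`-form research walls of LINE `cycint`
# on PRINT-located Kato inputs only — items stmt-BirchSwinnertonDyer-19219 `MultiplicativeRankZeroTwoConverse` /
# 19187 `MultTwoConverseOverKAtTwo` (helper; composition of LINE `cycint` v5)

Cell `bsd-2adic` (run/shared/lean/pub/bsd-2adic/), seat `bsd-2adic-conv-2` (GEN 13). THEOREMS ONLY — nothing asserted, no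
definition, no named fact, no class booked; BSD is not proved by any of this. PARTITION (D-0054): none — RANK axis (S3 mult, both
signs); companion formula cell X5@2 mult (K4ᵐ, B1·O1; 1 976 book230 classes).

WHY THIS FILE EXISTS. `Theorems/TwoAdicConverseMultLambdaWallSplit.lean` (this GEN) re-shaped the SPLIT research wall of LINE
`cycint` to `λ`-form on the per-curve K11 binder `X5.O1.KatoMultiplicativeDivisibilityRat W 2`, leaving the FEED of that binder
open: until today the split half of K11 rested on the Summits constant `MultKatoInputs.exists_multDivisibilityInputs_split_two`
(memo PROOF-KATO2SPLIT), which is why GEN 12 did not move the split stub (census R-GEN12-3: tier regression). Seat bsd-2adic-mult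
GEN 11 has now landed the PRINT-located split descent package `Literature/…/Kato2004/DivisibilityInputsMultiplicativeDescentSplit.lean`
(p495896): the construction fact `Kato2004.exists_multDivisibilityInputsDescent_split` (Kato §§12–17 over `ℚ_p(ζ_{p^∞})` read at
`T″(k−1) = ℤ_p`, `Δ`-descent, every field print-located or a labelled prime-independent bridge; EVERY `p`) and the kernel theorem
`Kato2004.katoDivisibility_splitMult_of_descentSplitFacts` (`X` torsion and `ι(T·g) = p^m·L`, `g ∈ char_Λ X`, from
`nonempty_iwasawaH1Data`, `thm12_4` and that fact). So the trigger GEN 12 named («K11b split package PRINT-located ⇒ R-GEN12-3»)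
has fired, and this file closes the loop on the S3 side:

* §1 `katoRatSplit_two_of_descentSplit` — the binder `hKsp : ∀ W split at 2, KatoMultiplicativeDivisibilityRat W 2` of the split
  `λ`-wall doors from PRINT-located inputs {`hne`, `h12`, `hdsp := exists_multDivisibilityInputsDescent_split`, Greenberg Thm. 1.5
  `h15`} — no Summits constant, no memo binder (S3-side projection; the mult lane's sign-uniform binder supersedes it for K4ᵐ);
* §2 `multiplicativeRankZeroTwoConverse_of_lamWalls_of_descents` / `multTwoConverseOverKAtTwo_of_lamWalls_of_descents` — the crux
  19219 and the SERVED crux 19187 BY NAME from PRINT {A235-twin, A236, modularity, Greenberg Thm. 1.5, Spieß 2014 Thm. 5.7 at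
  split-at-`2` curves} + PRINT-located Kato {`hne`, `h12`, `hdesc` (non-split), `hdsp` (split)} + the two research walls λ-WALL-ns
  (v4 stub verbatim) and λ-WALL-sp (this GEN) — **the composition of LINE `cycint` v5**, whose research content is now, for BOTH
  signs, «`λ_an ≤ λ_alg` (+1 at a split `2`) on the finite-`Sel` locus», `μ`-free, period-free, isogeny-free, Greenberg–Stevens-free;
* §3 the v5 PER-CURVE split door on the same PRINT-located inputs (`analyticRank_eq_zero_of_selmerCorank_eq_zero_split_two_of_lambdaPart_of_descentSplit`),
  for class files / anchors where the split `λ`-part is certified AT `W`.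

HONEST FRAMING. Neither wall is in print at `p = 2`; the rank-`0` 2-converse at a multiplicative `2` stays OPEN class-wide; the
PRINT-located Kato inputs carry the audit words of record (D-AUDIT-K11inputs ADD-3 for `hdesc`; the split sheet is the mult
lane's to request); nothing is booked.

References: Kato, Astérisque 295 (2004) 12.1, Thm. 12.4–12.6, Thm. 16.4, Prop. 17.11 / Lemma 17.12, §17.13 [Kato2004Asterisque];
Greenberg, LNM 1716 (1999) Thm. 1.5 (p. 61), §2, §4 pp. 112–113 [GreenbergLNM1716]; Spieß, Invent. Math. 196 (2014) Thm. 5.7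
[Spiess2014Invent]; Greenberg–Vatsal, Invent. Math. 142 (2000) p. 4 [GreenbergVatsal2000].
-/

set_option linter.dupNamespace false
set_option autoImplicit false

noncomputable section

open scoped Classical MatrixGroups ModularForm

open CongruenceSubgroup WeierstrassCurve Literature.NumberTheory.EllipticCurves
  Literature.NumberTheory.EllipticCurves.ModularForms
  Literature.NumberTheory.EllipticCurves.Greenberg1999
  Literature.NumberTheory.EllipticCurves.Spiess2014
  Literature.NumberTheory.EllipticCurves.Rank1Residual
  Literature.NumberTheory.EllipticCurves.Rank1Residual.Typed
  Summit.BirchSwinnertonDyer.Rank1Residual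
  Summit.BirchSwinnertonDyer.Rank1Residual.X1.MuLambda
  Summit.BirchSwinnertonDyer.Rank1Residual.X5
  Summit.BirchSwinnertonDyer.Rank1Residual.X5.O1
  Summit.BirchSwinnertonDyer.BirchSwinnertonDyer.Theses.TwoAdicConverse

namespace Summit.BirchSwinnertonDyer.BirchSwinnertonDyer.Theorems

namespace MultLambdaWall

/-! ## §1 The split K11 binder from PRINT-located inputs -/

/-- **The per-curve K11 binder at a SPLIT multiplicative `2` from PRINT-located inputs only** (S3-side projection of mult GEN 11's
kernel): for `W` split multiplicative at `2`, `X5.O1.KatoMultiplicativeDivisibilityRat W 2` (`X` torsion; `ι(T·g) = 2ⁿ·L₂`,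
`g ∈ char_Λ X`; the non-split clause vacuous) from Kato's `𝐇¹` construction `hne`, Thm. 12.4 `h12`, the split descent package
`hdsp : Kato2004.exists_multDivisibilityInputsDescent_split` (p495896) and Greenberg's Thm. 1.5 `h15` (torsion for `L = 0` too) —
the divisibility for `L ≠ 0` is `Kato2004.katoDivisibility_splitMult_of_descentSplitFacts`, for `L = 0` take `g = 0`; the
`ℤ₂`-continuity instance of `T₂W` is `TateModule.continuousSMul_padicInt`. No Summits constant, no memo binder.
[cite: Kato2004Asterisque, Thm. 17.4 (1)(2) (p. 273; shape), Prop. 17.11 / Lemma 17.12 (pp. 277–279), §17.13 (pp. 279–280)]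
[cite: GreenbergLNM1716, Thm. 1.5 (PDF p. 61)] -/
theorem katoRatSplit_two_of_descentSplit (hne : Kato2004.nonempty_iwasawaH1Data) (h12 : Kato2004.thm12_4)
    (hdsp : Kato2004.exists_multDivisibilityInputsDescent_split) (h15 : thm15_isTorsion_multiplicative_rat) :
    ∀ (W : WeierstrassCurve ℚ) [W.IsElliptic] [W.IsGloballyMinimal],
      W.HasSplitMultiplicativeReductionAtPrime 2 → KatoMultiplicativeDivisibilityRat W 2 := by
  intro W _ _ hspW κ γ hκ hγ hγ' hmult N _ f hf D
  haveI : ContinuousSMul ℤ_[2] (W.tateModule 2) := TateModule.continuousSMul_padicInt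
  refine ⟨h15 W 2 hmult f hf κ γ hκ hγ D, fun hns => absurd hspW hns, fun _ L hL => ?_⟩
  by_cases hL0 : L = 0
  · exact ⟨0, 0, Submodule.zero_mem _, by simp [hL0]⟩
  · obtain ⟨-, n, g, hg, hι⟩ := Kato2004.katoDivisibility_splitMult_of_descentSplitFacts hne h12 hdsp hspW hκ hγ hγ'
      hf hL hL0 D
    exact ⟨n, g, hg, hι⟩

/-! ## §2 LINE `cycint` v5: 19219 and 19187 BY NAME from the two `λ`-form walls on PRINT-located inputs -/

/-- **The crux `MultiplicativeRankZeroTwoConverse` (item 19219) from the two `λ`-form walls + PRINT-located inputs only.** PRINT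
{A235-twin `h41ns`, A236 `h41sp`, modularity `hmod`, Greenberg Thm. 1.5 `h15`, Spieß Thm. 5.7 at every split-at-`2` curve `hW`} +
PRINT-located Kato {`hne`, `h12`, `hdesc` (non-split descent package), `hdsp` (split descent package)} + λ-WALL-ns (`hWns`, v4 stub
verbatim) + λ-WALL-sp (`hWsp`) ⟹ 19219: `multiplicativeRankZeroTwoConverse_of_lamWalls_of_descent_of_katoRatSplit` with the binder
`hKsp` discharged by §1. No Summits constant, no memo binder, no Greenberg–Stevens, no `μ`, no period, no isogeny hedge.
[cite: Kato2004Asterisque, Thm. 17.4 (1)(2) (p. 273; shape) and §17.13 (pp. 279–280)] [cite: Spiess2014Invent, Thm. 5.7]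
[cite: GreenbergLNM1716, §4 pp. 112–113 and Thm. 1.5 (p. 61)] [cite: GreenbergVatsal2000, p. 4 (after Thm. (1.2))] -/
theorem multiplicativeRankZeroTwoConverse_of_lamWalls_of_descents
    (h41ns : thm41Analogue_charValue_rankZero_numberField_anyPrime_oddLocalDegree)
    (h41sp : thm41Analogue_charValue_rankZero_split_baseChange_anyPrime)
    (hmod : nonempty_modularParametrizationData) (h15 : thm15_isTorsion_multiplicative_rat)
    (hne : Kato2004.nonempty_iwasawaH1Data) (h12 : Kato2004.thm12_4)
    (hdesc : Kato2004.exists_multDivisibilityInputsDescent_nonsplit)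
    (hdsp : Kato2004.exists_multDivisibilityInputsDescent_split)
    (hW : ∀ (W : WeierstrassCurve ℚ) [W.IsElliptic] [W.IsGloballyMinimal],
      W.HasSplitMultiplicativeReductionAtPrime 2 → thm57_weakExceptionalZero_splitMultiplicative_rat W 2)
    (hWns : ∀ (W : WeierstrassCurve ℚ) [W.IsElliptic] [W.IsGloballyMinimal], ¬ W.HasCM → Mult W 2 →
      ¬ W.HasSplitMultiplicativeReductionAtPrime 2 → W.selmerCorank 2 = 0 →
      ∀ (κ : ZpExtension ℚ 2) (γ : Field.absoluteGaloisGroup ℚ), κ.IsCyclotomic →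
      κ.IsTopGenerator γ → IsCyclotomicVariable 2 γ →
      ∀ ⦃N : ℕ⦄ [NeZero N] (f : CuspForm (Gamma0 N) 2), IsNewformOf W f →
      ∀ (D : W.SelmerDualData κ γ) (g h : IwasawaAlgebra 2) (n : ℕ), D.charIdeal = Ideal.span {g} →
      ∀ L : PowerSeries ℚ_[2], IsMultPAdicLFunctionOf f 2 (-1) L →
        iwasawaToPowerSeries 2 (g * h) = PowerSeries.C ((2 : ℚ_[2]) ^ n) * L →
        g * h ≠ 0 ∧ lam (g * h) ≤ lam g)
    (hWsp : ∀ (W : WeierstrassCurve ℚ) [W.IsElliptic] [W.IsGloballyMinimal], ¬ W.HasCM → Mult W 2 →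
      W.HasSplitMultiplicativeReductionAtPrime 2 → W.selmerCorank 2 = 0 →
      ∀ (κ : ZpExtension ℚ 2) (γ : Field.absoluteGaloisGroup ℚ), κ.IsCyclotomic →
      κ.IsTopGenerator γ → IsCyclotomicVariable 2 γ →
      ∀ ⦃N : ℕ⦄ [NeZero N] (f : CuspForm (Gamma0 N) 2), IsNewformOf W f →
      ∀ (D : W.SelmerDualData κ γ) (g h : IwasawaAlgebra 2) (n : ℕ), D.charIdeal = Ideal.span {g} →
      ∀ L : PowerSeries ℚ_[2], IsSplitMultPAdicLFunctionOf f 2 L →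
        iwasawaToPowerSeries 2 (PowerSeries.X * (g * h)) = PowerSeries.C ((2 : ℚ_[2]) ^ n) * L →
        g * h ≠ 0 ∧ lam (g * h) ≤ lam g) :
    MultiplicativeRankZeroTwoConverse :=
  multiplicativeRankZeroTwoConverse_of_lamWalls_of_descent_of_katoRatSplit h41ns h41sp hmod h15 hne h12 hdesc hW
    (katoRatSplit_two_of_descentSplit hne h12 hdsp h15) hWns hWsp

/-- **The SERVED crux `MultTwoConverseOverKAtTwo` (item 19187) — composition of LINE `cycint` v5.** The route's PUB child
`MultConversePublishedInputsAtTwo` (`hP`, item 19185) + PRINT {A235-twin, A236, modularity, Thm. 1.5, Spieß Thm. 5.7} + PRINT-located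
Kato {`hne`, `h12`, `hdesc`, `hdsp`} + λ-WALL-ns + λ-WALL-sp ⟹ 19187, through `19219 ⟹ 19187` modulo PUB
(`multTwoConverseOverKAtTwo_of_multiplicativeRankZeroTwoConverse`, p418586). The four PUB stubs of v5 (`stub_pub`, `stub_pubKato`,
`stub_pubKatoSplit`, and Spieß inside `stub_pub`) are all named tree facts; the two research stubs are the `λ`-form walls.
[cite: Kato2004Asterisque, Cor. 14.3 (p. 235) and §17.13 (pp. 279–280)] [cite: Spiess2014Invent, Thm. 5.7]
[cite: GreenbergLNM1716, §4 pp. 112–113 and Thm. 1.5 (p. 61)] -/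
theorem multTwoConverseOverKAtTwo_of_lamWalls_of_descents (hP : MultConversePublishedInputsAtTwo)
    (h41ns : thm41Analogue_charValue_rankZero_numberField_anyPrime_oddLocalDegree)
    (h41sp : thm41Analogue_charValue_rankZero_split_baseChange_anyPrime)
    (hmod : nonempty_modularParametrizationData) (h15 : thm15_isTorsion_multiplicative_rat)
    (hne : Kato2004.nonempty_iwasawaH1Data) (h12 : Kato2004.thm12_4)
    (hdesc : Kato2004.exists_multDivisibilityInputsDescent_nonsplit)
    (hdsp : Kato2004.exists_multDivisibilityInputsDescent_split)
    (hW : ∀ (W : WeierstrassCurve ℚ) [W.IsElliptic] [W.IsGloballyMinimal],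
      W.HasSplitMultiplicativeReductionAtPrime 2 → thm57_weakExceptionalZero_splitMultiplicative_rat W 2)
    (hWns : ∀ (W : WeierstrassCurve ℚ) [W.IsElliptic] [W.IsGloballyMinimal], ¬ W.HasCM → Mult W 2 →
      ¬ W.HasSplitMultiplicativeReductionAtPrime 2 → W.selmerCorank 2 = 0 →
      ∀ (κ : ZpExtension ℚ 2) (γ : Field.absoluteGaloisGroup ℚ), κ.IsCyclotomic →
      κ.IsTopGenerator γ → IsCyclotomicVariable 2 γ →
      ∀ ⦃N : ℕ⦄ [NeZero N] (f : CuspForm (Gamma0 N) 2), IsNewformOf W f →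
      ∀ (D : W.SelmerDualData κ γ) (g h : IwasawaAlgebra 2) (n : ℕ), D.charIdeal = Ideal.span {g} →
      ∀ L : PowerSeries ℚ_[2], IsMultPAdicLFunctionOf f 2 (-1) L →
        iwasawaToPowerSeries 2 (g * h) = PowerSeries.C ((2 : ℚ_[2]) ^ n) * L →
        g * h ≠ 0 ∧ lam (g * h) ≤ lam g)
    (hWsp : ∀ (W : WeierstrassCurve ℚ) [W.IsElliptic] [W.IsGloballyMinimal], ¬ W.HasCM → Mult W 2 →
      W.HasSplitMultiplicativeReductionAtPrime 2 → W.selmerCorank 2 = 0 →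
      ∀ (κ : ZpExtension ℚ 2) (γ : Field.absoluteGaloisGroup ℚ), κ.IsCyclotomic →
      κ.IsTopGenerator γ → IsCyclotomicVariable 2 γ →
      ∀ ⦃N : ℕ⦄ [NeZero N] (f : CuspForm (Gamma0 N) 2), IsNewformOf W f →
      ∀ (D : W.SelmerDualData κ γ) (g h : IwasawaAlgebra 2) (n : ℕ), D.charIdeal = Ideal.span {g} →
      ∀ L : PowerSeries ℚ_[2], IsSplitMultPAdicLFunctionOf f 2 L →
        iwasawaToPowerSeries 2 (PowerSeries.X * (g * h)) = PowerSeries.C ((2 : ℚ_[2]) ^ n) * L →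
        g * h ≠ 0 ∧ lam (g * h) ≤ lam g) :
    MultTwoConverseOverKAtTwo :=
  multTwoConverseOverKAtTwo_of_multiplicativeRankZeroTwoConverse hP
    (multiplicativeRankZeroTwoConverse_of_lamWalls_of_descents h41ns h41sp hmod h15 hne h12 hdesc hdsp hW hWns hWsp)

/-! ## §3 The v5 per-curve split door on PRINT-located inputs -/

/-- **The v5 PER-CURVE split door on PRINT-located inputs** (for class files / anchors: no `∀`-wall needed when the split `λ`-part
is certified AT `W`): PRINT {A236, modularity, Spieß Thm. 5.7 at `(W,2)`} + PRINT-located Kato {`hne`, `h12`, `hdsp`, `h15`} + the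
split `λ`-part at `W` ⟹ (`corank_{ℤ₂} Sel_{2^∞}(W/ℚ) = 0 ⇒ L(W,1) ≠ 0 ∧ r_an(W) = 0`). The split twin of p491683's
`analyticRank_eq_zero_of_selmerCorank_eq_zero_nonsplit_two_of_lambdaPart_of_descent`.
[cite: Spiess2014Invent, Thm. 5.7 (F = ℚ, r = 1)] [cite: GreenbergLNM1716, §4 pp. 112–113 and Thm. 1.5 (p. 61)]
[cite: Kato2004Asterisque, Thm. 17.4 (1)(2) (p. 273; shape) and §17.13 (pp. 279–280)] -/
theorem analyticRank_eq_zero_of_selmerCorank_eq_zero_split_two_of_lambdaPart_of_descentSplit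
    (W : WeierstrassCurve ℚ) [W.IsElliptic] [W.IsGloballyMinimal]
    (h41sp : thm41Analogue_charValue_rankZero_split_baseChange_anyPrime)
    (hmod : nonempty_modularParametrizationData)
    (hW : thm57_weakExceptionalZero_splitMultiplicative_rat W 2)
    (hne : Kato2004.nonempty_iwasawaH1Data) (h12 : Kato2004.thm12_4)
    (hdsp : Kato2004.exists_multDivisibilityInputsDescent_split) (h15 : thm15_isTorsion_multiplicative_rat)
    (hmult : Mult W 2) (hsp : W.HasSplitMultiplicativeReductionAtPrime 2)
    (hlam : ∀ (κ : ZpExtension ℚ 2) (γ : Field.absoluteGaloisGroup ℚ), κ.IsCyclotomic →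
      κ.IsTopGenerator γ → IsCyclotomicVariable 2 γ →
      ∀ ⦃N : ℕ⦄ [NeZero N] (f : CuspForm (Gamma0 N) 2), IsNewformOf W f →
      ∀ (D : W.SelmerDualData κ γ) (g h : IwasawaAlgebra 2) (n : ℕ), D.charIdeal = Ideal.span {g} →
      ∀ L : PowerSeries ℚ_[2], IsSplitMultPAdicLFunctionOf f 2 L →
        iwasawaToPowerSeries 2 (PowerSeries.X * (g * h)) = PowerSeries.C ((2 : ℚ_[2]) ^ n) * L →
        g * h ≠ 0 ∧ lam (g * h) ≤ lam g)
    (hsel : W.selmerCorank 2 = 0) :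
    W.entireLFunction 1 ≠ 0 ∧ W.analyticRank = 0 :=
  analyticRank_eq_zero_of_selmerCorank_eq_zero_split_two_of_lambdaPart_of_katoRat W h41sp hmod hW
    (katoRatSplit_two_of_descentSplit hne h12 hdsp h15 W hsp) hmult hsp hlam hsel

end MultLambdaWall

end Summit.BirchSwinnertonDyer.BirchSwinnertonDyer.Theorems

end
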